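import Mathlib.GroupTheory.Transfer
import Mathlib.GroupTheory.Abelianization.Defs
import Mathlib.GroupTheory.Torsion
import Mathlib.Topology.Algebra.Group.TopologicalAbelianization
import Mathlib.Topology.Algebra.OpenSubgroup
import Mathlib.Topology.Algebra.ClopenNhdofOne
import Mathlib.Algebra.Colimit.Module
import Literature.AnabelianGeometry.EtaleTheta.Cyclotome
import HarnessLib

/-!
# [AbsTopIII] Cor. 1.10 (i)(a): the cyclotomes `μ_{ℚ/ℤ}(G)`, `μ_Ẑ(G)` of a profinite group

Mochizuki, *Topics in Absolute Anabelian Geometry III*, §1, Cor. 1.10 (i)(a), manuscript pp. 41–42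
(lit key `paper:url-5493eb38cbb7`; journal pagination not held):

  "(a) Write: `μ_{ℚ/ℤ}(G_k) := lim_{→ H} (H^ab)_tors`; `μ_Ẑ(G_k) := Hom(ℚ/ℤ, μ_{ℚ/ℤ}(G_k))` — where `H`
  ranges over the open subgroups of `G_k`; the notation "(−)_tors" denotes the torsion subgroup of
  the abelian group in parentheses; the arrows of the direct limit are induced by the Verlagerung,
  or transfer, map [cf. the discussion preceding [Mzk9], Proposition 1.2.1; the proof of [Mzk9],
  Proposition 1.2.1]."

Here `H^ab` is "the abelianization of a profinite group `H`, i.e., the quotient of `H` by the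
closure of the commutator subgroup of `H`" ([AbsTopI] §0 "Topological Groups", manuscript p. 8 of
`paper:url-11ac98ba15fc`) = Mathlib's `TopologicalAbelianization`.

This file makes the construction REAL (pure topological group theory over Mathlib, for any compact
topological group `G`; no field, no Galois theory):

* `continuous_transfer`: the transfer `G → A` of a continuous `ϕ : H → A` along an OPEN subgroup
  `H` of finite index is continuous (it is given on the normal core of `H` by a finite product of
  conjugates, `transfer_apply_of_mem_normalCore`);
* `verlagerung hU hV h : U^ab →* V^ab` for open subgroups `V ≤ U` of `G` — the transfer
  `U → V^ab` descended to the topological abelianization (it kills the CLOSURE of `[U, U]` by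
  continuity), and its restriction `verlagerungTorsion` to torsion subgroups;
* `muQZ G` = `μ_{ℚ/ℤ}(G)`, Mathlib's `AddCommGroup.DirectLimit` of the `(U^ab)_tors` (written
  additively) over the open subgroups `U` ordered by reverse inclusion, with structure maps
  `muQZ.of U : (U^ab)_tors → μ_{ℚ/ℤ}(G)` compatible with the Verlagerung (`muQZ.of_verlagerung`);
* `muZhat G` = `μ_Ẑ(G) := Hom(ℚ/ℤ, μ_{ℚ/ℤ}(G))`, realised through the tree's one cyclotome functor
  `Literature.AnabelianGeometry.EtaleTheta.cyclotome` (`= lim_n (−)[n] ≅ Hom(ℚ/ℤ, −)`).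

Not here (recorded): transitivity of the Verlagerung (so Mathlib's `DirectedSystem` instance is not
provided — the definition of the direct limit does not need it); the conjugation action of `G` on
`μ_{ℚ/ℤ}(G)`, functoriality in isomorphisms `G ≃ₜ* G'`, the comparison `μ_{ℚ/ℤ}(G_k) ≅ μ(k̄)` for an
MLF `k` (local class field theory, [AbsAnab] §1.2 p. 9) and "the natural isomorphism
`H²(G_k, μ_Ẑ(G_k)) ⥲ Ẑ`" of Cor. 1.10 (i)(a) — sibling file `GaloisCyclotomeFunctoriality.lean`.
-/

noncomputable section

open scoped Pointwise
open Topology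

universe u v

namespace Literature.AnabelianGeometry.AbsoluteAnabelian

/-! ### Continuity of the transfer along an open subgroup -/

section Transfer

variable {G : Type u} [Group G] {A : Type v} [CommGroup A] {H : Subgroup G}

/-- On the normal core `N` of `H` the transfer of `ϕ : H → A` is the finite product of the
conjugates of `ϕ` over a transversal `T` of `H`: `Ver(n) = ∏_{q ∈ G/H} ϕ(t_q⁻¹ · n · t_q)`
("the Verlagerung, or transfer, map", [AbsTopIII] Cor. 1.10 (i)(a) p. 42).
[cite: MochizukiAbsTopIII2015, Cor 1.10 (i) p.42] -/
theorem transfer_apply_of_mem_normalCore [H.FiniteIndex] (ϕ : H →* A) (T : H.LeftTransversal)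
    {n : G} (hn : n ∈ H.normalCore) :
    letI := H.fintypeQuotientOfFiniteIndex
    MonoidHom.transfer ϕ n =
      ∏ q : G ⧸ H, ϕ ⟨(T.2.leftQuotientEquiv q : G)⁻¹ * (n * T.2.leftQuotientEquiv q),
        by
          have h := H.normalCore.inv_mem hn
          have hc := (inferInstance : H.normalCore.Normal).conj_mem _ h
            (T.2.leftQuotientEquiv q : G)⁻¹
          rw [inv_inv] at hc
          have hc' := H.normalCore_le (H.normalCore.inv_mem hc)
          simpa [mul_assoc] using hc'⟩ := by
  letI := H.fintypeQuotientOfFiniteIndex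
  have hfix : ∀ q : G ⧸ H, n⁻¹ • q = q := by
    intro q
    induction q using QuotientGroup.induction_on with
    | H g =>
      rw [MulAction.Quotient.smul_coe, smul_eq_mul, QuotientGroup.eq]
      have h := (inferInstance : H.normalCore.Normal).conj_mem _ hn g⁻¹
      rw [inv_inv] at h
      simpa [mul_assoc] using H.normalCore_le h
  rw [MonoidHom.transfer_def ϕ T n]
  unfold Subgroup.leftTransversals.diff
  refine Finset.prod_congr rfl fun q _ => congrArg ϕ (Subtype.ext ?_)
  show (T.2.leftQuotientEquiv q : G)⁻¹ * ((n • T).2.leftQuotientEquiv q : G) =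
    (T.2.leftQuotientEquiv q : G)⁻¹ * (n * T.2.leftQuotientEquiv q)
  rw [Subgroup.smul_apply_eq_smul_apply_inv_smul, hfix, smul_eq_mul]

variable [TopologicalSpace G] [IsTopologicalGroup G] [TopologicalSpace A] [IsTopologicalGroup A]

/-- The transfer of a continuous homomorphism `ϕ : H → A` along an OPEN subgroup `H` of finite
index is continuous ([AbsTopIII] Cor. 1.10 (i)(a) p. 42: the Verlagerung between abelianizations of
open subgroups of a profinite group). [cite: MochizukiAbsTopIII2015, Cor 1.10 (i) p.42] -/
theorem continuous_transfer [H.FiniteIndex] (hH : IsOpen (H : Set G)) (ϕ : H →* A)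
    (hϕ : Continuous ϕ) : Continuous (MonoidHom.transfer ϕ) := by
  letI := H.fintypeQuotientOfFiniteIndex
  set N := H.normalCore with hNdef
  have hN : IsOpen (N : Set G) :=
    Subgroup.isOpen_of_isClosed_of_finiteIndex _
      (H.normalCore_isClosed (Subgroup.isClosed_of_isOpen H hH))
  let T : H.LeftTransversal := default
  -- the transfer restricted to `N`, as an explicit finite product
  have hmem : ∀ (n : N) (q : G ⧸ H),
      (T.2.leftQuotientEquiv q : G)⁻¹ * ((n : G) * T.2.leftQuotientEquiv q) ∈ H := by
    intro n q
    have h := N.inv_mem n.2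
    have hc := (inferInstance : N.Normal).conj_mem _ h (T.2.leftQuotientEquiv q : G)⁻¹
    rw [inv_inv] at hc
    have hc' := H.normalCore_le (N.inv_mem hc)
    simpa [mul_assoc] using hc'
  let F : N → A := fun n => ∏ q : G ⧸ H,
    ϕ ⟨(T.2.leftQuotientEquiv q : G)⁻¹ * ((n : G) * T.2.leftQuotientEquiv q), hmem n q⟩
  have hF : Continuous F := by
    refine continuous_finsetProd _ fun q _ => hϕ.comp ?_
    exact Continuous.subtype_mk
      (f := fun n : N => (T.2.leftQuotientEquiv q : G)⁻¹ * ((n : G) * T.2.leftQuotientEquiv q))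
      (continuous_const.mul (continuous_subtype_val.mul continuous_const)) fun n => hmem n q
  have hagree : (MonoidHom.transfer ϕ : G → A) ∘ ((↑) : N → G) = F := by
    funext n
    exact transfer_apply_of_mem_normalCore ϕ T n.2
  have h1 : ContinuousAt (MonoidHom.transfer ϕ : G → A) ((1 : N) : G) := by
    rw [← hN.isOpenEmbedding_subtypeVal.continuousAt_iff]
    have hc : Continuous ((MonoidHom.transfer ϕ : G → A) ∘ ((↑) : N → G)) := hagree ▸ hF
    exact hc.continuousAt
  exact continuous_of_continuousAt_one (MonoidHom.transfer ϕ) (by simpa using h1)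

end Transfer

/-! ### The Verlagerung between topological abelianizations of open subgroups -/

section Verlagerung

variable {G : Type u} [Group G] [TopologicalSpace G] [IsTopologicalGroup G] {U V : Subgroup G}

/-- `V ∩ U` (as a subgroup of `U`) `→ V → V^ab`, the homomorphism one transfers.
[cite: MochizukiAbsTopIII2015, Cor 1.10 (i) p.42] -/
def toAbelianizationOfLe (h : V ≤ U) : V.subgroupOf U →* TopologicalAbelianization V :=
  (QuotientGroup.mk' (commutator V).topologicalClosure).comp
    (Subgroup.subgroupOfEquivOfLe h).toMonoidHom

/-- `toAbelianizationOfLe` is continuous. [cite: MochizukiAbsTopIII2015, Cor 1.10 (i) p.42] -/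
theorem continuous_toAbelianizationOfLe (h : V ≤ U) : Continuous (toAbelianizationOfLe h) := by
  refine QuotientGroup.continuous_mk.comp ?_
  exact Continuous.subtype_mk (continuous_subtype_val.comp continuous_subtype_val) _

variable [CompactSpace G]

/-- An open subgroup `V ≤ U` of a compact group has finite index in the open subgroup `U`.
[cite: MochizukiAbsTopIII2015, Cor 1.10 (i) p.42] -/
theorem finiteIndex_subgroupOf (hU : IsOpen (U : Set G)) (hV : IsOpen (V : Set G)) :
    (V.subgroupOf U).FiniteIndex := by
  haveI : Finite (U ⧸ V.subgroupOf U) :=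
    Subgroup.quotient_finite_of_isOpen' U (V.subgroupOf U) hU (hV.preimage continuous_subtype_val)
  exact Subgroup.finiteIndex_of_finite_quotient

/-- The transfer `U → V^ab` for open subgroups `V ≤ U` of a compact group ("the Verlagerung, or
transfer, map", before descending to `U^ab`). [cite: MochizukiAbsTopIII2015, Cor 1.10 (i) p.42] -/
def transferToAbelianization (hU : IsOpen (U : Set G)) (hV : IsOpen (V : Set G)) (h : V ≤ U) :
    U →* TopologicalAbelianization V :=
  haveI := finiteIndex_subgroupOf hU hV
  MonoidHom.transfer (toAbelianizationOfLe h)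

/-- The transfer `U → V^ab` is continuous. [cite: MochizukiAbsTopIII2015, Cor 1.10 (i) p.42] -/
theorem continuous_transferToAbelianization (hU : IsOpen (U : Set G)) (hV : IsOpen (V : Set G))
    (h : V ≤ U) : Continuous (transferToAbelianization hU hV h) := by
  haveI := finiteIndex_subgroupOf hU hV
  exact continuous_transfer (hV.preimage continuous_subtype_val) _
    (continuous_toAbelianizationOfLe h)

/-- The closure of `[U, U]` dies in `V^ab` under the (continuous) transfer.
[cite: MochizukiAbsTopIII2015, Cor 1.10 (i) p.42] -/
theorem closure_commutator_le_ker (hU : IsOpen (U : Set G)) (hV : IsOpen (V : Set G))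
    (h : V ≤ U) :
    (commutator U).topologicalClosure ≤ (transferToAbelianization hU hV h).ker := by
  refine Subgroup.topologicalClosure_minimal _ (Abelianization.commutator_subset_ker _) ?_
  haveI : T1Space (TopologicalAbelianization V) :=
    QuotientGroup.t1Space_iff.mpr (Subgroup.isClosed_topologicalClosure _)
  rw [MonoidHom.coe_ker]
  exact isClosed_singleton.preimage (continuous_transferToAbelianization hU hV h)

/-- The **Verlagerung** `U^ab → V^ab` between the topological abelianizations of open subgroups
`V ≤ U` of a compact group: "the arrows of the direct limit are induced by the Verlagerung, or
transfer, map" ([AbsTopIII] Cor. 1.10 (i)(a) p. 42; [AbsAnab] §1.2 p. 11 "may be reconstructed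
group-theoretically by considering the Verlagerung"). [cite: MochizukiAbsTopIII2015, Cor 1.10 (i) p.42] -/
def verlagerung (hU : IsOpen (U : Set G)) (hV : IsOpen (V : Set G)) (h : V ≤ U) :
    TopologicalAbelianization U →* TopologicalAbelianization V :=
  QuotientGroup.lift _ (transferToAbelianization hU hV h) (closure_commutator_le_ker hU hV h)

/-- The Verlagerung on the class of `u ∈ U` is the transfer of `u`.
[cite: MochizukiAbsTopIII2015, Cor 1.10 (i) p.42] -/
@[simp] theorem verlagerung_mk (hU : IsOpen (U : Set G)) (hV : IsOpen (V : Set G)) (h : V ≤ U)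
    (u : U) : verlagerung hU hV h (QuotientGroup.mk u) = transferToAbelianization hU hV h u :=
  QuotientGroup.lift_mk _ _ _

/-- The Verlagerung is continuous. [cite: MochizukiAbsTopIII2015, Cor 1.10 (i) p.42] -/
theorem continuous_verlagerung (hU : IsOpen (U : Set G)) (hV : IsOpen (V : Set G)) (h : V ≤ U) :
    Continuous (verlagerung hU hV h) := by
  refine QuotientGroup.isOpenQuotientMap_mk.isQuotientMap.continuous_iff.mpr ?_
  exact continuous_transferToAbelianization hU hV h

/-- "`(H^ab)_tors` — the torsion subgroup of the abelian group in parentheses" (p. 42).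
[cite: MochizukiAbsTopIII2015, Cor 1.10 (i) p.42] -/
abbrev abelianizationTorsion (U : Subgroup G) : Subgroup (TopologicalAbelianization U) :=
  CommGroup.torsion (TopologicalAbelianization U)

/-- The Verlagerung on torsion subgroups `(U^ab)_tors → (V^ab)_tors` (a homomorphism preserves
finite order). [cite: MochizukiAbsTopIII2015, Cor 1.10 (i) p.42] -/
def verlagerungTorsion (hU : IsOpen (U : Set G)) (hV : IsOpen (V : Set G)) (h : V ≤ U) :
    abelianizationTorsion U →* abelianizationTorsion V :=
  ((verlagerung hU hV h).restrict (abelianizationTorsion U)).codRestrict _ fun x =>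
    (CommGroup.mem_torsion _).mpr
      ((verlagerung hU hV h).isOfFinOrder ((CommGroup.mem_torsion _).mp x.2))

/-- Underlying formula for `verlagerungTorsion`. [cite: MochizukiAbsTopIII2015, Cor 1.10 (i) p.42] -/
@[simp] theorem coe_verlagerungTorsion (hU : IsOpen (U : Set G)) (hV : IsOpen (V : Set G))
    (h : V ≤ U) (x : abelianizationTorsion U) :
    (verlagerungTorsion hU hV h x : TopologicalAbelianization V) = verlagerung hU hV h x :=
  rfl

end Verlagerung

/-! ### `μ_{ℚ/ℤ}(G)` and `μ_Ẑ(G)` -/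

section Cyclotome

variable (G : Type u) [Group G] [TopologicalSpace G] [IsTopologicalGroup G] [CompactSpace G]

open scoped Classical in
/-- The direct system `U ↦ (U^ab)_tors` over the open subgroups of `G` ordered by REVERSE
inclusion (`(OpenSubgroup G)ᵒᵈ`; cofinal = small subgroups), with the Verlagerung as transition
maps, written additively. [cite: MochizukiAbsTopIII2015, Cor 1.10 (i) p.42] -/
def muQZSystem (U V : (OpenSubgroup G)ᵒᵈ) (h : U ≤ V) :
    Additive (abelianizationTorsion ((OrderDual.ofDual U : OpenSubgroup G) : Subgroup G)) →+
      Additive (abelianizationTorsion ((OrderDual.ofDual V : OpenSubgroup G) : Subgroup G)) :=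
  MonoidHom.toAdditive
    (verlagerungTorsion (OrderDual.ofDual U).isOpen (OrderDual.ofDual V).isOpen
      (OpenSubgroup.toSubgroup_le.mpr (OrderDual.ofDual_le_ofDual.mpr h)))

open scoped Classical in
/-- **`μ_{ℚ/ℤ}(G) := lim_{→ H} (H^ab)_tors`**, "where `H` ranges over the open subgroups of `G`
[...] the arrows of the direct limit are induced by the Verlagerung" ([AbsTopIII] Cor. 1.10 (i)(a)
p. 41–42) — Mathlib's direct limit of abelian groups (written additively).  For `G = G_k`, `k` an
MLF, local class field theory identifies `(H^ab)_tors` with `μ(k_H)` and this limit with `μ(k̄)`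
([AbsAnab] §1.2 p. 9–11); that comparison is a named fact of the sibling file, not used here.
[cite: MochizukiAbsTopIII2015, Cor 1.10 (i) p.41] -/
def muQZ : Type u :=
  AddCommGroup.DirectLimit
    (fun U : (OpenSubgroup G)ᵒᵈ =>
      Additive (abelianizationTorsion ((OrderDual.ofDual U : OpenSubgroup G) : Subgroup G)))
    (muQZSystem G)

open scoped Classical in
/-- `μ_{ℚ/ℤ}(G)` is an abelian group. [cite: MochizukiAbsTopIII2015, Cor 1.10 (i) p.41] -/
instance muQZ.instAddCommGroup : AddCommGroup (muQZ G) := by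
  unfold muQZ
  infer_instance

variable {G}

open scoped Classical in
/-- The structure map `(U^ab)_tors → μ_{ℚ/ℤ}(G)` of the direct limit, for an open subgroup `U`.
[cite: MochizukiAbsTopIII2015, Cor 1.10 (i) p.41] -/
def muQZ.of (U : OpenSubgroup G) : Additive (abelianizationTorsion (U : Subgroup G)) →+ muQZ G :=
  AddCommGroup.DirectLimit.of _ (muQZSystem G) (OrderDual.toDual U)

open scoped Classical in
/-- Compatibility of the structure maps with the Verlagerung: for open `V ≤ U` and
`x ∈ (U^ab)_tors`, the images of `x` and of `Ver(x) ∈ (V^ab)_tors` in `μ_{ℚ/ℤ}(G)` agree.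
[cite: MochizukiAbsTopIII2015, Cor 1.10 (i) p.42] -/
theorem muQZ.of_verlagerung {U V : OpenSubgroup G} (h : V ≤ U)
    (x : abelianizationTorsion (U : Subgroup G)) :
    muQZ.of V (Additive.ofMul (verlagerungTorsion U.isOpen V.isOpen
      (OpenSubgroup.toSubgroup_le.mpr h) x)) = muQZ.of U (Additive.ofMul x) := by
  have := AddCommGroup.DirectLimit.of_f (G := fun U : (OpenSubgroup G)ᵒᵈ =>
      Additive (abelianizationTorsion ((OrderDual.ofDual U : OpenSubgroup G) : Subgroup G)))
    (f := muQZSystem G) (i := OrderDual.toDual U) (j := OrderDual.toDual V)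
    (OrderDual.toDual_le_toDual.mpr h) (Additive.ofMul x)
  exact this

/-- Every element of `μ_{ℚ/ℤ}(G)` comes from `(U^ab)_tors` for some open subgroup `U`.
[cite: MochizukiAbsTopIII2015, Cor 1.10 (i) p.41] -/
theorem muQZ.exists_of (z : muQZ G) :
    ∃ (U : OpenSubgroup G) (x : abelianizationTorsion (U : Subgroup G)),
      muQZ.of U (Additive.ofMul x) = z := by
  classical
  induction z using AddCommGroup.DirectLimit.induction_on with
  | ih i x => exact ⟨OrderDual.ofDual i, Additive.toMul x, rfl⟩

variable (G)

/-- **`μ_Ẑ(G) := Hom(ℚ/ℤ, μ_{ℚ/ℤ}(G))`** ([AbsTopIII] Cor. 1.10 (i)(a) p. 41), realised — up to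
the canonical isomorphism `Hom(ℚ/ℤ, A) ≅ lim_n A[n]` — by the tree's cyclotome functor
`EtaleTheta.cyclotome` applied to `μ_{ℚ/ℤ}(G)` (read multiplicatively).
[cite: MochizukiAbsTopIII2015, Cor 1.10 (i) p.41] -/
def muZhat : Subgroup (ℕ+ → Multiplicative (muQZ G)) :=
  EtaleTheta.cyclotome (Multiplicative (muQZ G))

/-- `μ_Ẑ(G)` unfolded: compatible families of torsion elements of `μ_{ℚ/ℤ}(G)`.
[cite: MochizukiAbsTopIII2015, Cor 1.10 (i) p.41] -/
theorem mem_muZhat_iff (ζ : ℕ+ → Multiplicative (muQZ G)) :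
    ζ ∈ muZhat G ↔ (∀ n : ℕ+, ζ n ^ (n : ℕ) = 1) ∧ ∀ n m : ℕ+, ζ (n * m) ^ (m : ℕ) = ζ n :=
  EtaleTheta.cyclotome.mem_iff ζ

end Cyclotome

end Literature.AnabelianGeometry.AbsoluteAnabelian
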